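import Summits.QuantumFields.YangMills.Theses.PencilRigidity
import Summits.QuantumFields.YangMills.Theses.MirrorModularBoosts
import Literature.MathematicalPhysics.QuantumFieldTheory.YangMillsOS
import Literature.MathematicalPhysics.QuantumFieldTheory.TorusFreeTransfer
import Literature.MathematicalPhysics.QuantumFieldTheory.LatticeGaugeStrongCouplingProofs

/-!
# Scratch evidence for stub `stub_coldTwistedTraceDescent` (S3): the `β ≡ 0` slice

NOT a landing file (it proves no registered stub).  It machine-checks the claim of
`stub_coldTwistedTraceDescent.blocked.md` §3: along any scheme with `β_k = 0` (arbitrary renormalisations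
`c_k, m_k`), `CoverInsensitivity r sch` holds — in fact `latticeSchwinger = coverSchwinger` for all large `k`
(compactly supported test functions): both sides are product-Haar integrals of the same cylinder function of
`ℤ⁴`-edges, on whose support both the periodic and the skew-periodic edge maps are injective.

Vocabulary: verbatim copies of the skeleton blocks §1, §2 (`skewProj`, `skewLift`, `coverSchwinger`,
`CoverInsensitivity`) in the skeleton's namespace.
-/

set_option autoImplicit false

noncomputable section

open scoped SchwartzMap ComplexConjugate
open MeasureTheory Filter Topology
open Literature.MathematicalPhysics.QuantumLattice Literature.MathematicalPhysics.AQFT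
  Literature.MathematicalPhysics.QuantumFieldTheory

namespace Summit.QuantumFields.YangMills.Cruxes.DiagonalMirrorRPR.ParityBridgeColdTraces

/-- Euclidean `ℝ⁴`, time = coordinate `0`. -/
abbrev E4 : Type := EuclideanSpace ℝ (Fin 4)

/-! ## §1 (verbatim) -/

/-- Sites of the box torus. -/
abbrev TSite (n₀ n₁ N : ℕ) : Type := ZMod n₀ × ZMod n₁ × ZMod N × ZMod N

/-- Positively oriented edges `(x, i)`: from `x` to `x + tstep i`. -/
abbrev TEdge (n₀ n₁ N : ℕ) : Type := TSite n₀ n₁ N × Fin 4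

/-- Configurations: a group element per positively oriented edge. -/
abbrev TConfig (n₀ n₁ N : ℕ) (G : Type*) : Type _ := TEdge n₀ n₁ N → G

/-- `2N ≠ 0`. -/
instance neZero_two_mul (N : ℕ) [NeZero N] : NeZero (2 * N) := ⟨mul_ne_zero two_ne_zero (NeZero.ne N)⟩

section BoxTorus

variable {n₀ n₁ N : ℕ}

/-- Step vectors (`shear = true`: the `e₁`-tstep is `(−1, 1, 0, 0)`). -/
def tstep (shear : Bool) (i : Fin 4) : TSite n₀ n₁ N :=
  ![((1 : ZMod n₀), (0 : ZMod n₁), (0 : ZMod N), (0 : ZMod N)),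
    ((if shear then -1 else 0 : ZMod n₀), (1 : ZMod n₁), (0 : ZMod N), (0 : ZMod N)),
    ((0 : ZMod n₀), (0 : ZMod n₁), (1 : ZMod N), (0 : ZMod N)),
    ((0 : ZMod n₀), (0 : ZMod n₁), (0 : ZMod N), (1 : ZMod N))] i

variable {G : Type*} [Group G]

/-- Plaquette holonomy `U(x,i) U(x+eᵢ,j) U(x+eⱼ,i)⁻¹ U(x,j)⁻¹`. -/
def tplaq (shear : Bool) (U : TConfig n₀ n₁ N G) (x : TSite n₀ n₁ N) (i j : Fin 4) : G :=
  U (x, i) * U (x + tstep shear i, j) * (U (x + tstep shear j, i))⁻¹ * (U (x, j))⁻¹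

variable {Nc : ℕ} (ρ : G →* Matrix (Fin Nc) (Fin Nc) ℂ)

/-- Wilson's action `∑ₓ ∑_{i<j} Re tr ρ(U_p)` (tree normalisation of `wilsonMeasure`, up to the constant). -/
def taction [NeZero n₀] [NeZero n₁] [NeZero N] (shear : Bool) (U : TConfig n₀ n₁ N G) : ℝ :=
  ∑ x : TSite n₀ n₁ N, ∑ i : Fin 4, ∑ j : Fin 4,
    if i < j then (ρ (tplaq shear U x i j)).trace.re else 0

/-- Boltzmann weight `exp(β · action)`. -/
def tweight [NeZero n₀] [NeZero n₁] [NeZero N] (β : ℝ) (shear : Bool) (U : TConfig n₀ n₁ N G) : ℝ :=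
  Real.exp (β * taction ρ shear U)

variable [TopologicalSpace G] [IsTopologicalGroup G] [CompactSpace G] [MeasurableSpace G] [BorelSpace G]

/-- Product of normalised Haar measures over the edges. -/
def thaar (n₀ n₁ N : ℕ) [NeZero n₀] [NeZero n₁] [NeZero N] : Measure (TConfig n₀ n₁ N G) :=
  Measure.pi fun _ : TEdge n₀ n₁ N => haarProbability G

/-- Partition function `Z = ∫ exp(β · action) dHaar`. -/
def tZ (n₀ n₁ N : ℕ) [NeZero n₀] [NeZero n₁] [NeZero N] (β : ℝ) (shear : Bool) : ℝ :=
  ∫ U, tweight ρ β shear U ∂(thaar n₀ n₁ N : Measure (TConfig n₀ n₁ N G))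

/-- Normalised (complex) expectation `⟨F⟩ = Z⁻¹ ∫ F exp(β · action) dHaar`. -/
def texp [NeZero n₀] [NeZero n₁] [NeZero N] (β : ℝ) (shear : Bool) (F : TConfig n₀ n₁ N G → ℂ) : ℂ :=
  (∫ U, F U * ((tweight ρ β shear U : ℝ) : ℂ) ∂(thaar n₀ n₁ N : Measure (TConfig n₀ n₁ N G))) /
    ((tZ ρ n₀ n₁ N β shear : ℝ) : ℂ)

end BoxTorus

/-! ## §2 (verbatim, the parts used) -/

section Cover

variable {N : ℕ} [NeZero N]

variable {G : Type} [Group G] [TopologicalSpace G] [IsTopologicalGroup G] [CompactSpace G]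
  [MeasurableSpace G] [BorelSpace G] {Nc : ℕ}

/-- Reduction of `ℤ⁴` modulo `Λ̃_N = ⟨N(e₀+e₁), N(e₀−e₁), Ne₂, Ne₃⟩`, in the chart `(u,w) = (x₀−x₁, x₁)`:
a group homomorphism `ℤ⁴ → ℤ_{2N} × ℤ_N × ℤ_N²` with kernel `Λ̃_N`, `e₀ ↦ (1,0,0,0)`, `e₁ ↦ (−1,1,0,0)`. -/
def skewProj (N : ℕ) (x : Fin 4 → ℤ) : TSite (2 * N) N N :=
  (((x 0 - x 1 : ℤ) : ZMod (2 * N)), ((x 1 : ℤ) : ZMod N), ((x 2 : ℤ) : ZMod N), ((x 3 : ℤ) : ZMod N))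

/-- The `Λ̃_N`-periodic lift of a cover configuration to a configuration of `ℤ⁴` (the analogue of
`torusLift`). -/
def skewLift (N : ℕ) (U : TConfig (2 * N) N N G) : LGConfig 4 G := fun e => U (skewProj N e.1, e.2)

/-- The curvature-string `n`-point function at tstep `k` computed on the 2:1 COVER `T̃_{N_k}` (`N_k = sch.side k`)
with the scheme's spacing, coupling and renormalisations — `latticeSchwinger` with the odd torus replaced by
its 45° double cover (same smearing box `[-L_k, L_k]⁴ ⊂ ℤ⁴`, same `a_k, c_k, m_k`). -/
def coverSchwinger (r : LatticeRep G) (sch : SpeciesScheme (YMSpecies G)) (k n : ℕ)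
    (f : Fin n → 𝓢(E4, ℝ)) : ℝ :=
  (texp r.ρ (sch.β k) true fun U : TConfig (2 * sch.side k) (sch.side k) (sch.side k) G =>
    ((∏ i, smearedLatticeField r.curvature.F (Literature.Probability.LatticeModels.box 4 (sch.L k))
        (sch.a k) (sch.c r.curvature k) (sch.m r.curvature k) (f i) (skewLift (sch.side k) U) : ℝ) : ℂ)).re

/-- **Cover insensitivity** of the scheme: for compactly supported real test functions the curvature strings
computed on the statement's torus `ℤ⁴/N_kℤ⁴` and on its 45° double cover have the same limit behaviour
(difference `→ 0`). -/
def CoverInsensitivity (r : LatticeRep G) (sch : SpeciesScheme (YMSpecies G)) : Prop :=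
  ∀ (n : ℕ), n ≠ 0 → ∀ (f : Fin n → 𝓢(E4, ℝ)), (∀ i, HasCompactSupport (f i)) →
    Tendsto (fun k : ℕ => latticeSchwinger r.ρ sch (fun s => s.F) k n (fun _ => r.curvature) f -
      coverSchwinger r sch k n f) atTop (𝓝 0)

end Cover

/-! ## The `β ≡ 0` slice -/

section Beta0

variable {G : Type} [Group G] [TopologicalSpace G] [IsTopologicalGroup G] [CompactSpace G]
  [MeasurableSpace G] [BorelSpace G]

/-- The skew edge map `e ↦ (skewProj N e.1, e.2)` (so that `skewLift N U = U ∘ skewEdge N`). -/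
def skewEdge (N : ℕ) (e : Literature.MathematicalPhysics.QuantumLattice.ZdEdge 4) : TEdge (2 * N) N N := (skewProj N e.1, e.2)

omit [Group G] [TopologicalSpace G] [IsTopologicalGroup G] [CompactSpace G] [MeasurableSpace G] [BorelSpace G] in
theorem skewLift_eq_comp (N : ℕ) (U : TConfig (2 * N) N N G) : skewLift N U = U ∘ skewEdge N := rfl

/-- The skew edge map of `T̃_{2L+1}` is injective on edges based in the cube `[-L, L]⁴`. -/
theorem skewEdge_injOn (L : ℕ) {S : Finset (Literature.MathematicalPhysics.QuantumLattice.ZdEdge 4)}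
    (hS : ∀ e ∈ S, e.1 ∈ Literature.Probability.LatticeModels.box 4 L) :
    Set.InjOn (skewEdge (2 * L + 1)) S := by
  intro e he e' he' h
  have hb := Literature.Probability.LatticeModels.mem_box.1 (hS e he)
  have hb' := Literature.Probability.LatticeModels.mem_box.1 (hS e' he')
  simp only [skewEdge, skewProj, Prod.mk.injEq] at h
  obtain ⟨⟨h0, h1, h2, h3⟩, hdir⟩ := h
  have key : ∀ j : Fin 4, ((e.1 j : ℤ) : ZMod (2 * L + 1)) = ((e'.1 j : ℤ) : ZMod (2 * L + 1)) →
      e.1 j = e'.1 j := by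
    intro j hj
    have hdvd := (ZMod.intCast_eq_intCast_iff_dvd_sub _ _ _).1 hj
    obtain ⟨lo, hi⟩ := hb j
    obtain ⟨lo', hi'⟩ := hb' j
    have hlt : |e'.1 j - e.1 j| < ((2 * L + 1 : ℕ) : ℤ) := by
      rw [abs_lt]; push_cast; constructor <;> omega
    have h0 := Int.eq_zero_of_abs_lt_dvd hdvd hlt
    omega
  have e1 : e.1 1 = e'.1 1 := key 1 h1
  have e2 : e.1 2 = e'.1 2 := key 2 h2
  have e3 : e.1 3 = e'.1 3 := key 3 h3
  have e0 : e.1 0 = e'.1 0 := by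
    have hdvd := (ZMod.intCast_eq_intCast_iff_dvd_sub _ _ _).1 h0
    obtain ⟨lo, hi⟩ := hb 0
    obtain ⟨lo', hi'⟩ := hb' 0
    have hlt : |(e'.1 0 - e'.1 1) - (e.1 0 - e.1 1)| < ((2 * (2 * L + 1) : ℕ) : ℤ) := by
      rw [abs_lt]; push_cast; constructor <;> omega
    have h00 := Int.eq_zero_of_abs_lt_dvd hdvd hlt
    omega
  refine Prod.ext (funext fun j => ?_) hdir
  match j with
  | 0 => exact e0
  | 1 => exact e1
  | 2 => exact e2
  | 3 => exact e3

/-- **Skew transfer lemma** (the analogue of `integral_torusLift_eq_integral_zdHaar` for `skewLift`). -/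
theorem integral_skewLift_eq_integral_zdHaar {N : ℕ} [NeZero N] {S : Finset (Literature.MathematicalPhysics.QuantumLattice.ZdEdge 4)}
    (hinj : Set.InjOn (skewEdge N) S) {F : LGConfig 4 G → ℝ} (hFm : Measurable F)
    (hdep : DependsOn F (S : Set (Literature.MathematicalPhysics.QuantumLattice.ZdEdge 4))) :
    ∫ U, F (skewLift N U) ∂(thaar (2 * N) N N : Measure (TConfig (2 * N) N N G)) =
      ∫ U, F U ∂(zdHaar 4 G) := by
  classical
  obtain ⟨F', hF'm, hFF'⟩ :=
    Literature.Probability.LatticeModels.exists_measurable_comp_restrict S (1 : LGConfig 4 G) hFm hdep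
  have hτ : Function.Injective fun s : ↥S => skewEdge N s := fun s s' h =>
    Subtype.ext (hinj s.2 s'.2 h)
  have hm : Measurable fun (U : TConfig (2 * N) N N G) (s : ↥S) => U (skewEdge N s) :=
    measurable_pi_lambda _ fun s => measurable_pi_apply _
  have h1 : ∫ U, F (skewLift N U) ∂(thaar (2 * N) N N : Measure (TConfig (2 * N) N N G)) =
      ∫ u, F' u ∂(Measure.pi fun _ : ↥S => haarProbability G) := by
    rw [thaar, ← map_comp_pi_of_injective (haarProbability G) hτ,
      integral_map hm.aemeasurable hF'm.aestronglyMeasurable, hFF']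
    rfl
  have h2 : ∫ U, F U ∂(zdHaar 4 G) = ∫ u, F' u ∂(Measure.pi fun _ : ↥S => haarProbability G) := by
    rw [zdHaar, ← Measure.infinitePi_map_restrict (μ := fun _ : Literature.MathematicalPhysics.QuantumLattice.ZdEdge 4 => haarProbability G)
      (I := S), integral_map (Finset.measurable_restrict S).aemeasurable hF'm.aestronglyMeasurable, hFF']
    rfl
  rw [h1, h2]

/-- At `β = 0` the box-torus partition function is `1`. -/
theorem tZ_zero {Nc : ℕ} (ρ : G →* Matrix (Fin Nc) (Fin Nc) ℂ) (n₀ n₁ N : ℕ) [NeZero n₀] [NeZero n₁]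
    [NeZero N] (shear : Bool) : tZ ρ n₀ n₁ N 0 shear = 1 := by
  simp [tZ, tweight, thaar]

/-- At `β = 0` the box-torus expectation is the product-Haar integral. -/
theorem texp_zero {Nc : ℕ} (ρ : G →* Matrix (Fin Nc) (Fin Nc) ℂ) {n₀ n₁ N : ℕ} [NeZero n₀] [NeZero n₁]
    [NeZero N] (shear : Bool) (F : TConfig n₀ n₁ N G → ℂ) :
    texp ρ 0 shear F = ∫ U, F U ∂(thaar n₀ n₁ N : Measure (TConfig n₀ n₁ N G)) := by
  simp [texp, tweight, tZ_zero]

/-- Edges based in the cube `[-L, L]⁴`. -/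
def SBox (L : ℕ) : Finset (Literature.MathematicalPhysics.QuantumLattice.ZdEdge 4) := Literature.Probability.LatticeModels.box 4 L ×ˢ Finset.univ

/-- The product of smeared curvature fields, as an observable of `ℤ⁴`. -/
def smearProd (r : LatticeRep G) (sch : SpeciesScheme (YMSpecies G)) (k n : ℕ) (f : Fin n → 𝓢(E4, ℝ))
    (V : LGConfig 4 G) : ℝ :=
  ∏ i, smearedLatticeField r.curvature.F (Literature.Probability.LatticeModels.box 4 (sch.L k))
    (sch.a k) (sch.c r.curvature k) (sch.m r.curvature k) (f i) V

theorem latticeSchwinger_eq_integral_smearProd (r : LatticeRep G) (sch : SpeciesScheme (YMSpecies G))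
    (k n : ℕ) (f : Fin n → 𝓢(E4, ℝ)) :
    latticeSchwinger r.ρ sch (fun s => s.F) k n (fun _ => r.curvature) f =
      ∫ U, smearProd r sch k n f (torusLift (sch.side k) U)
        ∂(wilsonMeasure (d := 4) (L := sch.side k) r.ρ (sch.β k)) := rfl

theorem coverSchwinger_eq_texp_smearProd (r : LatticeRep G) (sch : SpeciesScheme (YMSpecies G))
    (k n : ℕ) (f : Fin n → 𝓢(E4, ℝ)) :
    coverSchwinger r sch k n f =
      (texp r.ρ (sch.β k) true fun U : TConfig (2 * sch.side k) (sch.side k) (sch.side k) G =>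
        ((smearProd r sch k n f (skewLift (sch.side k) U) : ℝ) : ℂ)).re := rfl

theorem measurable_smearProd (r : LatticeRep G) (sch : SpeciesScheme (YMSpecies G)) (k n : ℕ)
    (f : Fin n → 𝓢(E4, ℝ)) : Measurable (smearProd r sch k n f) := by
  unfold smearProd
  refine Finset.measurable_prod _ fun i _ => ?_
  unfold smearedLatticeField
  refine Measurable.const_mul ?_ _
  refine Finset.measurable_sum _ fun x _ => ?_
  exact ((r.curvature.measurable.comp (configShift (-x)).measurable).sub measurable_const).const_mul _

/-- Edges of the curvature species' support have base coordinates in `{0, 1}`. -/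
theorem curvature_supp_coord (r : LatticeRep G) {e : Literature.MathematicalPhysics.QuantumLattice.ZdEdge 4} (he : e ∈ r.curvature.supp) (j : Fin 4) :
    0 ≤ e.1 j ∧ e.1 j ≤ 1 := by
  simp only [LatticeRep.curvature, Finset.mem_biUnion, Finset.mem_univ, true_and,
    originPlaquetteSupport, Finset.mem_insert, Finset.mem_singleton] at he
  obtain ⟨p, hp⟩ := he
  rcases hp with rfl | rfl | rfl | rfl <;> simp [Pi.single_apply] <;> split_ifs <;> simp

/-- If every lattice point seen by some `fᵢ` lies in the cube `[-(L-1), L-1]⁴`, the smeared product depends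
only on the edges based in `[-L, L]⁴`. -/
theorem dependsOn_smearProd (r : LatticeRep G) (sch : SpeciesScheme (YMSpecies G)) (k n : ℕ)
    (f : Fin n → 𝓢(E4, ℝ))
    (hgood : ∀ i (x : Fin 4 → ℤ), f i (sch.a k • siteToE x) ≠ 0 → ∀ j, |x j| + 1 ≤ (sch.L k : ℤ)) :
    DependsOn (smearProd r sch k n f) ((SBox (sch.L k) : Finset (Literature.MathematicalPhysics.QuantumLattice.ZdEdge 4)) : Set (Literature.MathematicalPhysics.QuantumLattice.ZdEdge 4)) := by
  intro V V' hVV'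
  unfold smearProd
  refine Finset.prod_congr rfl fun i _ => ?_
  unfold smearedLatticeField
  congr 1
  refine Finset.sum_congr rfl fun x _ => ?_
  by_cases h0 : f i (sch.a k • siteToE x) = 0
  · rw [h0, zero_mul, zero_mul]
  · have hO : r.curvature.F (configShift (-x) V) = r.curvature.F (configShift (-x) V') := by
      refine r.curvature.isCylinder fun e he => ?_
      rw [configShift_apply, configShift_apply]
      refine hVV' _ ?_
      have hc := curvature_supp_coord r (Finset.mem_coe.1 he)
      have hx := hgood i x h0
      simp only [SBox, Finset.coe_product, Finset.coe_univ, Set.mem_prod, Set.mem_univ, and_true,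
        Finset.mem_coe, Literature.Probability.LatticeModels.mem_box]
      intro j
      obtain ⟨hc1, hc2⟩ := hc j
      have hxj : |x j| ≤ (sch.L k : ℤ) - 1 := by have := hx j; omega
      obtain ⟨hx1, hx2⟩ := abs_le.1 hxj
      simp only [Pi.sub_apply, Pi.neg_apply, sub_neg_eq_add]
      constructor <;> omega
    rw [hO]

/-- `wilsonMeasure` at `β = 0` is the product Haar measure (as in `Disproof` §2). -/
theorem wilsonMeasure_zero (r : LatticeRep G) (M : ℕ) [NeZero M] :
    wilsonMeasure (d := 4) (L := M) r.ρ 0 = Measure.pi fun _ => haarProbability G := by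
  have h1 : wilsonWeight (d := 4) (L := M) r.ρ 0 = Measure.pi fun _ => haarProbability G := by
    unfold wilsonWeight
    simp only [neg_zero, zero_mul, Real.exp_zero, ENNReal.ofReal_one]
    exact withDensity_one
  unfold wilsonMeasure partitionFunction
  rw [h1, measure_univ, inv_one, one_smul]

/-- **At `β_k = 0` and large `k`, the torus and the cover give the same curvature strings — exactly.** -/
theorem latticeSchwinger_eq_coverSchwinger_of_beta_eq_zero (r : LatticeRep G)
    (sch : SpeciesScheme (YMSpecies G)) (k n : ℕ) (hβ : sch.β k = 0) (f : Fin n → 𝓢(E4, ℝ)) (R : ℝ)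
    (hR : ∀ i x, f i x ≠ 0 → ‖x‖ ≤ R) (ha1 : sch.a k ≤ 1) (hRL : R + 1 ≤ sch.a k * sch.L k) :
    latticeSchwinger r.ρ sch (fun s => s.F) k n (fun _ => r.curvature) f = coverSchwinger r sch k n f := by
  have hgood : ∀ i (x : Fin 4 → ℤ), f i (sch.a k • siteToE x) ≠ 0 → ∀ j, |x j| + 1 ≤ (sch.L k : ℤ) := by
    intro i x hx j
    have hapos := sch.a_pos k
    have h1 : ‖sch.a k • siteToE x‖ ≤ R := hR i _ hx
    have h2 : |sch.a k * (x j : ℝ)| ≤ R := by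
      have := PiLp.norm_apply_le (sch.a k • siteToE x) j
      rw [PiLp.smul_apply, siteToE_apply, smul_eq_mul, Real.norm_eq_abs] at this
      exact this.trans h1
    rw [abs_mul, abs_of_pos hapos] at h2
    have h3 : sch.a k * (((|x j| : ℤ) : ℝ) + 1) ≤ sch.a k * sch.L k := by
      have : sch.a k * (((|x j| : ℤ) : ℝ) + 1) = sch.a k * |(x j : ℝ)| + sch.a k := by push_cast; ring
      rw [this]; linarith
    have h4 : ((|x j| : ℤ) : ℝ) + 1 ≤ sch.L k := le_of_mul_le_mul_left h3 hapos
    exact_mod_cast h4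
  have hPm := measurable_smearProd r sch k n f
  have hdep := dependsOn_smearProd r sch k n f hgood
  have hS : ∀ e ∈ SBox (sch.L k), e.1 ∈ Literature.Probability.LatticeModels.box 4 (sch.L k) :=
    fun e he => (Finset.mem_product.1 he).1
  have lhs : latticeSchwinger r.ρ sch (fun s => s.F) k n (fun _ => r.curvature) f =
      ∫ U, smearProd r sch k n f U ∂(zdHaar 4 G) := by
    rw [latticeSchwinger_eq_integral_smearProd, hβ, wilsonMeasure_zero]
    have hinj : Set.InjOn (torusEdge (d := 4) (sch.side k)) (SBox (sch.L k)) :=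
      torusEdge_injOn (n := sch.L k) (L := 2 * sch.L k) le_rfl hS
    exact integral_torusLift_eq_integral_zdHaar hinj hPm hdep
  have rhs : coverSchwinger r sch k n f = ∫ U, smearProd r sch k n f U ∂(zdHaar 4 G) := by
    rw [coverSchwinger_eq_texp_smearProd, hβ, texp_zero, integral_complex_ofReal, Complex.ofReal_re]
    have hinj : Set.InjOn (skewEdge (sch.side k)) (SBox (sch.L k)) := skewEdge_injOn _ hS
    exact integral_skewLift_eq_integral_zdHaar hinj hPm hdep
  rw [lhs, rhs]

/-- **`β ≡ 0` ⇒ cover insensitivity (exactly, eventually), whatever `c_k`, `m_k`.** -/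
theorem coverInsensitivity_of_beta_eq_zero (r : LatticeRep G) (sch : SpeciesScheme (YMSpecies G))
    (hβ : ∀ k, sch.β k = 0) : CoverInsensitivity r sch := by
  intro n _ f hf
  obtain ⟨R, hR⟩ : ∃ R : ℝ, ∀ i x, f i x ≠ 0 → ‖x‖ ≤ R := by
    have hRi : ∀ i, ∃ Ri : ℝ, ∀ x, f i x ≠ 0 → ‖x‖ ≤ Ri := by
      intro i
      obtain ⟨Ri, hRi⟩ := ((hf i).isCompact.isBounded).subset_closedBall (0 : E4)
      refine ⟨Ri, fun x hx => ?_⟩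
      have hx' : x ∈ tsupport (f i) := subset_tsupport _ (Function.mem_support.2 hx)
      exact mem_closedBall_zero_iff.1 (hRi hx')
    choose Ri hRi using hRi
    exact ⟨∑ i, |Ri i|, fun i x hx => (hRi i x hx).trans ((le_abs_self _).trans
      (Finset.single_le_sum (f := fun j => |Ri j|) (fun _ _ => abs_nonneg _) (Finset.mem_univ i)))⟩
  have ha : ∀ᶠ k in atTop, sch.a k ≤ 1 :=
    (sch.tendsto_a.eventually (gt_mem_nhds (by norm_num : (0 : ℝ) < 1))).mono fun k hk => hk.le
  have hL : ∀ᶠ k in atTop, R + 1 ≤ sch.a k * sch.L k := sch.tendsto_L.eventually (eventually_ge_atTop _)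
  refine tendsto_const_nhds.congr' ?_
  filter_upwards [ha, hL] with k hak hLk
  rw [latticeSchwinger_eq_coverSchwinger_of_beta_eq_zero r sch k n (hβ k) f R hR hak hLk, sub_self]

end Beta0

end Summit.QuantumFields.YangMills.Cruxes.DiagonalMirrorRPR.ParityBridgeColdTraces

end
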